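import Literature.Topology.FourManifolds.FishtailProfile
import Mathlib.Analysis.SpecialFunctions.Complex.Arg
import Mathlib.Analysis.SpecialFunctions.Complex.Log
import Mathlib.Analysis.Real.Pi.Bounds
import HarnessLib

/-!
# The tube about Gompf's collar annulus: profile tubes and the switch of the second normal

Continuation of `FishtailProfile.lean` (R. Gompf, *More Cappell–Shaneson spheres are standard*,
Algebr. Geom. Topol. 10 (2010), proof of Thm 2.1: the collar annulus `A` of the disc `D`, and
Lemma 2.2: the boundary of a tubular neighbourhood of `D`). The annulus is a surface of revolution
about the puncture `q₀` in the cap chart: offset `P = u e^{iϑ}` from `q₀`, height `y`, and fibre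
angle `ℓ = ϑ`. Its tube is written with two transverse fields: `e₁` in the meridian plane (the
shells of `FishtailProfile.lean`) and `e₂`, which is `-∂_ℓ` near the sphere (`ℓ = ϑ - b`) and the
tangential direction `i e^{iϑ}` of the cap chart up the cylinder (so that the tube stays injective
where the radius of the cylinder shrinks to `0`); the two are joined on the segment
`2.2ρ ≤ y ≤ 3ρ` of the cylinder of radius `2ρ` by `e₂ = (1 - χ) i e^{iϑ} - χ ∂_ℓ`, which is
transverse for every `χ ∈ [0, 1]`.

* `Literature.Topology.FourManifolds.profTube r y ϑ b = (r e^{iϑ}, y, ϑ - b)` and its injectivity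
  modulo `2π` (`profTube_inj`): the bend, flat and foot shells become tubes;
* `Literature.Topology.FourManifolds.tubeUp ρ y ϑ a b` — **the tube up the cylinder**:
  `P = (U(y) + a k(y) + i (1 - χ(y)) b) e^{iϑ}`, `y' = y + a p(y)`, `ℓ = ϑ - χ(y) b`, with
  `U = 2ρ` up to `y = 3ρ` shrinking to `0` at `4ρ`, `χ = 1` up to `2.2ρ` and `0` from `3ρ`,
  `(k, p)` the foot coefficients (so that below `2ρ` it is the foot tube); smooth;
* **injectivity of the switch** (`switch_inj`): `(a, b) ↦ e^{iχb}(U + a + i(1-χ)b)` is injective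
  for `|a|, |b| ≤ ρ/2` (`U = 2ρ`), by strict monotonicity of `b ↦ χ b + arcsin((1-χ) b / m)`;
  and of the whole upper tube above `2ρ` (`tubeUp_inj_of_le`).

Everything is proved; no named facts.

## References

* R. E. Gompf, *More Cappell–Shaneson spheres are standard*, Algebr. Geom. Topol. 10 (2010)
  1665–1681, proof of Thm 2.1 and Lemma 2.2. [GompfAGT2010]
-/

noncomputable section

open scoped Real ContDiff Topology
open Set Function Filter Complex

namespace Literature.Topology.FourManifolds

/-! ### Angles equal modulo `2π` and close are equal -/

section Angles

/-- **If `e^{iθ} = e^{iθ'}` and `|θ - θ'| < 2π` then `θ = θ'`.** [folklore] -/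
theorem eq_of_cexp_eq_of_abs_sub_lt {θ θ' : ℝ} (h : exp (θ * I) = exp (θ' * I)) (hd : |θ - θ'| < 2 * π) : θ = θ' := by
  obtain ⟨n, hn⟩ := Complex.exp_eq_exp_iff_exists_int.1 h
  have hre := congrArg Complex.im hn
  simp at hre
  -- `θ = θ' + n 2π`
  have hθ : θ = θ' + n * (2 * π) := by linarith
  have hn0 : (n : ℝ) = 0 := by
    have h1 : |(n : ℝ)| * (2 * π) < 2 * π := by
      have : |θ - θ'| = |(n : ℝ)| * (2 * π) := by
        rw [hθ, add_sub_cancel_left, abs_mul, abs_of_pos (by positivity : (0 : ℝ) < 2 * π)]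
      rwa [this] at hd
    have h2 : |(n : ℝ)| < 1 := by nlinarith [Real.pi_pos, abs_nonneg (n : ℝ)]
    have h3 : |n| < 1 := by exact_mod_cast h2
    have : n = 0 := Int.abs_lt_one_iff.mp h3
    simp [this]
  rw [hθ, hn0]; ring

end Angles

/-! ### Profile tubes -/

section ProfTube

/-- **The tube over a meridian shell point** `(r, y)` at revolution angle `ϑ` with second normal
coordinate `b` along `-∂_ℓ`: `(r e^{iϑ}, y, ϑ - b)`. [folklore] -/
def profTube (r y ϑ b : ℝ) : ℂ × ℝ × ℝ := ((r : ℂ) * exp (ϑ * I), y, ϑ - b)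

/-- The profile tube is smooth in all four arguments. [folklore] -/
theorem contDiff_profTube : ContDiff ℝ ∞ fun q : ℝ × ℝ × ℝ × ℝ ↦ profTube q.1 q.2.1 q.2.2.1 q.2.2.2 := by
  unfold profTube
  refine ((ofRealCLM.contDiff.comp contDiff_fst).mul (Complex.contDiff_exp.comp
    ((ofRealCLM.contDiff.comp (contDiff_fst.comp (contDiff_snd.comp contDiff_snd))).mul contDiff_const))).prodMk
    ((contDiff_fst.comp contDiff_snd).prodMk ((contDiff_fst.comp (contDiff_snd.comp contDiff_snd)).sub
      (contDiff_snd.comp (contDiff_snd.comp contDiff_snd))))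

/-- The norm of the first component is `r` (`r ≥ 0`). [folklore] -/
theorem norm_profTube_fst {r : ℝ} (hr : 0 ≤ r) (y ϑ b : ℝ) : ‖(profTube r y ϑ b).1‖ = r := by
  rw [profTube]; simp [norm_exp_ofReal_mul_I, abs_of_nonneg hr]

/-- **Injectivity of profile tubes modulo `2π`**: equal tubes with `r, r' > 0` and
`|b|, |b'| < π/2` have equal `(r, y, b)` and `e^{iϑ} = e^{iϑ'}`. [folklore] -/
theorem profTube_inj {r r' y y' ϑ ϑ' b b' : ℝ} (hr : 0 < r) (hr' : 0 < r') (hb : |b| < π / 2) (hb' : |b'| < π / 2)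
    (h : profTube r y ϑ b = profTube r' y' ϑ' b') :
    r = r' ∧ y = y' ∧ b = b' ∧ exp (ϑ * I) = exp (ϑ' * I) := by
  simp only [profTube, Prod.mk.injEq] at h
  obtain ⟨h1, h2, h3⟩ := h
  have hrr : r = r' := by
    have := congrArg norm h1
    simpa [norm_exp_ofReal_mul_I, abs_of_pos hr, abs_of_pos hr'] using this
  have he : exp (ϑ * I) = exp (ϑ' * I) := by
    rw [hrr] at h1
    exact mul_left_cancel₀ (by exact_mod_cast hr'.ne') h1
  refine ⟨hrr, h2, ?_, he⟩
  -- `ϑ - ϑ' ∈ 2πℤ` and `b - b' = ϑ - ϑ'` small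
  obtain ⟨n, hn⟩ := Complex.exp_eq_exp_iff_exists_int.1 he
  have him := congrArg Complex.im hn
  simp at him
  have hθ : ϑ = ϑ' + n * (2 * π) := by linarith
  have hbb : b - b' = n * (2 * π) := by linarith
  have hn0 : n = 0 := by
    have h4 : |(n : ℝ)| * (2 * π) < π := by
      have : |b - b'| = |(n : ℝ)| * (2 * π) := by
        rw [hbb, abs_mul, abs_of_pos (by positivity : (0 : ℝ) < 2 * π)]
      rw [← this]
      have := abs_sub b b'  -- `|b - b'| ≤ |b| + |b'|`
      linarith
    have h5 : |(n : ℝ)| < 1 := by nlinarith [Real.pi_pos, abs_nonneg (n : ℝ)]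
    have h6 : |n| < 1 := by exact_mod_cast h5
    exact Int.abs_lt_one_iff.mp h6
  rw [hn0] at hbb; simp at hbb; linarith

end ProfTube

/-! ### The tube up the cylinder -/

section Up

variable (ρ : ℝ)

/-- The radius of the cylinder: `2ρ` up to `y = 3ρ`, shrinking to `0` at `4ρ`. [cite: GompfAGT2010, Thm 2.1 (proof: the collar connecting ∂F to N)] -/
def uU (y : ℝ) : ℝ := 2 * ρ * (1 - Real.smoothTransition ((y - 3 * ρ) / ρ))

/-- The switch profile of the second normal: `1` (`-∂_ℓ`) up to `2.2ρ`, `0` (`i e^{iϑ}`) from `3ρ`. [folklore] -/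
def chiU (y : ℝ) : ℝ := 1 - Real.smoothTransition ((y - 11 * ρ / 5) / (4 * ρ / 5))

/-- **The tube up the cylinder**:
`(P, y', ℓ) = ((U + a k + i (1 - χ) b) e^{iϑ}, y + a p, ϑ - χ b)`. [cite: GompfAGT2010, Lemma 2.2 (proof: the boundary of the tubular neighbourhood of D)] -/
def tubeUp (y ϑ a b : ℝ) : ℂ × ℝ × ℝ :=
  ((((uU ρ y + a * footKc ρ y : ℝ) : ℂ) + (((1 - chiU ρ y) * b : ℝ) : ℂ) * I) * exp (ϑ * I),
    y + a * footPc ρ y, ϑ - chiU ρ y * b)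

variable {ρ} (hρ : 0 < ρ)

/-- `uU_of_le`. [folklore] -/
theorem uU_of_le (hρ : 0 < ρ) {y : ℝ} (h : y ≤ 3 * ρ) : uU ρ y = 2 * ρ := by
  rw [uU, Real.smoothTransition.zero_of_nonpos (div_nonpos_of_nonpos_of_nonneg (by linarith) hρ.le)]; ring

/-- `uU_of_ge`. [folklore] -/
theorem uU_of_ge (hρ : 0 < ρ) {y : ℝ} (h : 4 * ρ ≤ y) : uU ρ y = 0 := by
  rw [uU, Real.smoothTransition.one_of_one_le (by rw [le_div_iff₀ hρ]; linarith)]; ring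

/-- `uU_mem`. [folklore] -/
theorem uU_mem (hρ : 0 < ρ) (y : ℝ) : uU ρ y ∈ Icc 0 (2 * ρ) := by
  have h1 := Real.smoothTransition.nonneg ((y - 3 * ρ) / ρ)
  have h2 := Real.smoothTransition.le_one ((y - 3 * ρ) / ρ)
  rw [uU]; constructor <;> nlinarith

/-- `chiU_of_le`. [folklore] -/
theorem chiU_of_le (hρ : 0 < ρ) {y : ℝ} (h : y ≤ 11 * ρ / 5) : chiU ρ y = 1 := by
  rw [chiU, Real.smoothTransition.zero_of_nonpos (div_nonpos_of_nonpos_of_nonneg (by linarith) (by linarith)), sub_zero]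

/-- `chiU_of_ge`. [folklore] -/
theorem chiU_of_ge (hρ : 0 < ρ) {y : ℝ} (h : 3 * ρ ≤ y) : chiU ρ y = 0 := by
  rw [chiU, Real.smoothTransition.one_of_one_le (by rw [le_div_iff₀ (by linarith)]; linarith), sub_self]

/-- `chiU_mem`. [folklore] -/
theorem chiU_mem (y : ℝ) : chiU ρ y ∈ Icc (0 : ℝ) 1 := by
  constructor
  · rw [chiU]; linarith [Real.smoothTransition.le_one ((y - 11 * ρ / 5) / (4 * ρ / 5))]
  · rw [chiU]; linarith [Real.smoothTransition.nonneg ((y - 11 * ρ / 5) / (4 * ρ / 5))]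

/-- `contDiff_uU`. [folklore] -/
theorem contDiff_uU : ContDiff ℝ ∞ (uU ρ) :=
  contDiff_const.mul (contDiff_const.sub (Real.smoothTransition.contDiff.comp ((contDiff_id.sub contDiff_const).div_const _)))

/-- `contDiff_chiU`. [folklore] -/
theorem contDiff_chiU : ContDiff ℝ ∞ (chiU ρ) :=
  contDiff_const.sub (Real.smoothTransition.contDiff.comp ((contDiff_id.sub contDiff_const).div_const _))

include hρ in
/-- The tube up the cylinder is smooth in all four arguments. [folklore] -/
theorem contDiff_tubeUp : ContDiff ℝ ∞ fun q : ℝ × ℝ × ℝ × ℝ ↦ tubeUp ρ q.1 q.2.1 q.2.2.1 q.2.2.2 := by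
  have hy : ContDiff ℝ ∞ fun q : ℝ × ℝ × ℝ × ℝ ↦ q.1 := contDiff_fst
  have hϑ : ContDiff ℝ ∞ fun q : ℝ × ℝ × ℝ × ℝ ↦ q.2.1 := contDiff_fst.comp contDiff_snd
  have ha : ContDiff ℝ ∞ fun q : ℝ × ℝ × ℝ × ℝ ↦ q.2.2.1 := contDiff_fst.comp (contDiff_snd.comp contDiff_snd)
  have hb : ContDiff ℝ ∞ fun q : ℝ × ℝ × ℝ × ℝ ↦ q.2.2.2 := contDiff_snd.comp (contDiff_snd.comp contDiff_snd)
  have hk := (contDiff_footKc hρ).comp hy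
  have hp := (contDiff_footPc hρ).comp hy
  have hu := (contDiff_uU (ρ := ρ)).comp hy
  have hc := (contDiff_chiU (ρ := ρ)).comp hy
  unfold tubeUp
  refine ((((ofRealCLM.contDiff.comp (hu.add (ha.mul hk))).add ((ofRealCLM.contDiff.comp
    ((contDiff_const.sub hc).mul hb)).mul contDiff_const)).mul
      (Complex.contDiff_exp.comp ((ofRealCLM.contDiff.comp hϑ).mul contDiff_const))).prodMk ?_)
  exact (hy.add (ha.mul hp)).prodMk (hϑ.sub (hc.mul hb))

include hρ in
/-- **Below `2.2ρ` the tube up the cylinder is the foot tube**: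
`tubeUp y ϑ a b = profTube (footPt y a).1 (footPt y a).2 ϑ b`. [folklore] -/
theorem tubeUp_of_le {y : ℝ} (h : y ≤ 11 * ρ / 5) (ϑ a b : ℝ) :
    tubeUp ρ y ϑ a b = profTube (footPt ρ y a).1 (footPt ρ y a).2 ϑ b := by
  rw [tubeUp, profTube, footPt, chiU_of_le hρ h, uU_of_le hρ (by linarith)]
  simp

include hρ in
/-- **From `3ρ` on the tube is the plain cylinder tube** `((U + a + ib) e^{iϑ}, y, ϑ)`. [folklore] -/
theorem tubeUp_of_ge {y : ℝ} (h : 3 * ρ ≤ y) (ϑ a b : ℝ) :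
    tubeUp ρ y ϑ a b = ((((uU ρ y + a : ℝ) : ℂ) + (b : ℂ) * I) * exp (ϑ * I), y, ϑ) := by
  rw [tubeUp, chiU_of_ge hρ h, footKc, footPc, footM_of_ge (by linarith) hρ]
  simp

/-! #### Injectivity of the switch -/

/-- **The switch map** `(a, b) ↦ e^{iχb} (U + a + i (1 - χ) b)`. [folklore] -/
def switchMap (U χ a b : ℝ) : ℂ := exp ((χ * b : ℝ) * I) * ((U + a : ℝ) + ((1 - χ) * b : ℝ) * I)

include hρ in
/-- The tube up the cylinder above `2ρ` in terms of the switch map: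
`P e^{-iℓ} = switchMap U χ a b` with `ℓ` the third component. [folklore] -/
theorem tubeUp_fst_eq {y : ℝ} (hy : 2 * ρ ≤ y) (ϑ a b : ℝ) :
    (tubeUp ρ y ϑ a b).1 = switchMap (uU ρ y) (chiU ρ y) a b * exp ((tubeUp ρ y ϑ a b).2.2 * I) := by
  have h2 : (tubeUp ρ y ϑ a b).2.2 = ϑ - chiU ρ y * b := rfl
  have hk : footKc ρ y = 1 := by rw [footKc, footM_of_ge hy hρ]; ring
  have h1 : (tubeUp ρ y ϑ a b).1 =
      (((uU ρ y + a * footKc ρ y : ℝ) : ℂ) + (((1 - chiU ρ y) * b : ℝ) : ℂ) * I) * exp (ϑ * I) := rfl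
  rw [h2, h1, hk, mul_one, switchMap, mul_comm (exp (((chiU ρ y * b : ℝ) : ℂ) * I)) _, mul_assoc, ← Complex.exp_add]
  congr 2
  push_cast
  ring

/-- One-sided strictness behind the switch: for `b < b'` with `|(1-χ)b|, |(1-χ)b'| ≤ m`,
`χ b + arcsin((1-χ)b/m) < χ b' + arcsin((1-χ)b'/m)` (`0 ≤ χ ≤ 1`, `m > 0`). [folklore] -/
theorem switchFun_lt {χ m b b' : ℝ} (hχ0 : 0 ≤ χ) (hχ1 : χ ≤ 1) (hm : 0 < m) (hbm : |(1 - χ) * b| ≤ m)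
    (hbm' : |(1 - χ) * b'| ≤ m) (hlt : b < b') :
    χ * b + Real.arcsin ((1 - χ) * b / m) < χ * b' + Real.arcsin ((1 - χ) * b' / m) := by
  have hle : Real.arcsin ((1 - χ) * b / m) ≤ Real.arcsin ((1 - χ) * b' / m) :=
    Real.monotone_arcsin (div_le_div_of_nonneg_right (mul_le_mul_of_nonneg_left hlt.le (by linarith)) hm.le)
  rcases lt_or_eq_of_le hχ0 with hpos | hzero
  · have : χ * b < χ * b' := mul_lt_mul_of_pos_left hlt hpos
    linarith
  · subst hzero
    simp only [zero_mul, zero_add, sub_zero, one_mul] at hbm hbm' ⊢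
    have h1 : b / m ∈ Icc (-1 : ℝ) 1 := by
      rw [mem_Icc, le_div_iff₀ hm, div_le_iff₀ hm]; have := abs_le.1 hbm; constructor <;> linarith
    have h2 : b' / m ∈ Icc (-1 : ℝ) 1 := by
      rw [mem_Icc, le_div_iff₀ hm, div_le_iff₀ hm]; have := abs_le.1 hbm'; constructor <;> linarith
    exact Real.strictMonoOn_arcsin h1 h2 (div_lt_div_of_pos_right hlt hm)

/-- **Injectivity of the switch map**: for `0 ≤ χ ≤ 1`, `U + a, U + a' > 0` and `|b|, |b'| ≤ 1`,
equal values force `(a, b) = (a', b')`. [folklore] -/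
theorem switch_inj {U χ a a' b b' : ℝ} (hχ0 : 0 ≤ χ) (hχ1 : χ ≤ 1) (ha : 0 < U + a) (ha' : 0 < U + a')
    (hb : |b| ≤ 1) (hb' : |b'| ≤ 1) (h : switchMap U χ a b = switchMap U χ a' b') : a = a' ∧ b = b' := by
  -- the two vectors before rotation
  let w : ℂ := ((U + a : ℝ) : ℂ) + (((1 - χ) * b : ℝ) : ℂ) * I
  let w' : ℂ := ((U + a' : ℝ) : ℂ) + (((1 - χ) * b' : ℝ) : ℂ) * I
  have hwre : w.re = U + a := by simp [w]
  have hwim : w.im = (1 - χ) * b := by simp [w]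
  have hwre' : w'.re = U + a' := by simp [w']
  have hwim' : w'.im = (1 - χ) * b' := by simp [w']
  have hw0 : w ≠ 0 := fun h0 ↦ by have := congrArg Complex.re h0; rw [hwre] at this; simp at this; linarith
  have hsm : switchMap U χ a b = exp ((χ * b : ℝ) * I) * w := rfl
  have hsm' : switchMap U χ a' b' = exp ((χ * b' : ℝ) * I) * w' := rfl
  -- norms agree
  have hnorm : ‖w‖ = ‖w'‖ := by
    have := congrArg norm h
    rwa [hsm, hsm', norm_mul, norm_mul, norm_exp_ofReal_mul_I, norm_exp_ofReal_mul_I, one_mul, one_mul] at this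
  have hmpos : 0 < ‖w‖ := norm_pos_iff.2 hw0
  -- arguments
  have harg : arg w = Real.arcsin ((1 - χ) * b / ‖w‖) := by rw [arg_of_re_nonneg (by rw [hwre]; linarith), hwim]
  have harg' : arg w' = Real.arcsin ((1 - χ) * b' / ‖w‖) := by
    rw [arg_of_re_nonneg (by rw [hwre']; linarith), hwim', hnorm]
  have habs : |arg w| ≤ π / 2 := Complex.abs_arg_le_pi_div_two_iff.2 (by rw [hwre]; linarith)
  have habs' : |arg w'| ≤ π / 2 := Complex.abs_arg_le_pi_div_two_iff.2 (by rw [hwre']; linarith)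
  -- polar forms
  have h1 : switchMap U χ a b = (‖w‖ : ℂ) * exp ((χ * b + arg w : ℝ) * I) := by
    rw [hsm]
    conv_lhs => rw [← Complex.norm_mul_exp_arg_mul_I w]
    rw [mul_left_comm, ← Complex.exp_add]
    congr 1; push_cast; ring
  have h1' : switchMap U χ a' b' = (‖w‖ : ℂ) * exp ((χ * b' + arg w' : ℝ) * I) := by
    rw [hsm', hnorm]
    conv_lhs => rw [← Complex.norm_mul_exp_arg_mul_I w']
    rw [mul_left_comm, ← Complex.exp_add]
    congr 1; push_cast; ring
  have hexp : exp ((χ * b + arg w : ℝ) * I) = exp ((χ * b' + arg w' : ℝ) * I) := by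
    rw [h1, h1'] at h
    exact mul_left_cancel₀ (by exact_mod_cast hmpos.ne') h
  have hθ : χ * b + arg w = χ * b' + arg w' := by
    refine eq_of_cexp_eq_of_abs_sub_lt hexp ?_
    have hχb : |χ * b| ≤ 1 := by rw [abs_mul, abs_of_nonneg hχ0]; nlinarith [abs_nonneg b]
    have hχb' : |χ * b'| ≤ 1 := by rw [abs_mul, abs_of_nonneg hχ0]; nlinarith [abs_nonneg b']
    have hπ := Real.pi_gt_three
    calc |χ * b + arg w - (χ * b' + arg w')| = |(χ * b - χ * b') + (arg w - arg w')| := by ring_nf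
      _ ≤ |χ * b - χ * b'| + |arg w - arg w'| := abs_add_le _ _
      _ ≤ (|χ * b| + |χ * b'|) + (|arg w| + |arg w'|) := add_le_add (abs_sub _ _) (abs_sub _ _)
      _ < 2 * π := by linarith
  -- `b = b'`
  have hbm : |(1 - χ) * b| ≤ ‖w‖ := by rw [← hwim]; exact Complex.abs_im_le_norm w
  have hbm' : |(1 - χ) * b'| ≤ ‖w‖ := by rw [← hwim', hnorm]; exact Complex.abs_im_le_norm w'
  rw [harg, harg'] at hθ
  have hbb : b = b' := by
    rcases lt_trichotomy b b' with hlt | heq | hgt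
    · exact absurd hθ (switchFun_lt hχ0 hχ1 hmpos hbm hbm' hlt).ne
    · exact heq
    · exact absurd hθ.symm (switchFun_lt hχ0 hχ1 hmpos hbm' hbm hgt).ne
  refine ⟨?_, hbb⟩
  -- `a = a'` from the norms
  have hsq : ‖w‖ ^ 2 = ‖w'‖ ^ 2 := by rw [hnorm]
  rw [Complex.sq_norm, Complex.sq_norm, Complex.normSq_apply, Complex.normSq_apply, hwre, hwim, hwre', hwim', hbb] at hsq
  nlinarith

include hρ in
/-- **Injectivity of the tube up the cylinder, above `2ρ`**: for `2ρ ≤ y, y'`, `|a|, |a'| ≤ ρ/2`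
(and `< 1`), `|b|, |b'| ≤ 1`, equal tubes have equal `(y, a, b)` and `e^{iϑ} = e^{iϑ'}`. [folklore] -/
theorem tubeUp_inj_of_le {y y' ϑ ϑ' a a' b b' : ℝ} (hy : 2 * ρ ≤ y) (hy' : 2 * ρ ≤ y')
    (ha : |a| ≤ ρ / 2) (ha' : |a'| ≤ ρ / 2) (hb : |b| ≤ 1) (hb' : |b'| ≤ 1)
    (h : tubeUp ρ y ϑ a b = tubeUp ρ y' ϑ' a' b') : y = y' ∧ a = a' ∧ b = b' ∧ exp (ϑ * I) = exp (ϑ' * I) := by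
  have hfst := congrArg Prod.fst h
  have hsnd := congrArg (fun q ↦ q.2.1) h
  have hthd := congrArg (fun q ↦ q.2.2) h
  -- `y = y'` (above `2ρ` the height is preserved)
  have hyy : y = y' := by
    have e1 : (tubeUp ρ y ϑ a b).2.1 = y := by rw [tubeUp, footPc, footM_of_ge hy hρ]; simp
    have e2 : (tubeUp ρ y' ϑ' a' b').2.1 = y' := by rw [tubeUp, footPc, footM_of_ge hy' hρ]; simp
    rw [e1, e2] at hsnd; exact hsnd
  subst hyy
  -- the switch map values agree
  have hsw : switchMap (uU ρ y) (chiU ρ y) a b = switchMap (uU ρ y) (chiU ρ y) a' b' := by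
    have e1 := tubeUp_fst_eq hρ hy ϑ a b
    have e2 := tubeUp_fst_eq hρ hy ϑ' a' b'
    rw [hfst, e2, hthd] at e1
    exact (mul_right_cancel₀ (Complex.exp_ne_zero _) e1).symm
  have hχ := chiU_mem (ρ := ρ) y
  -- positivity of `U + a`: either `y ≤ 3ρ` (`U = 2ρ`) or `χ = 0` where we argue directly
  rcases le_or_gt y (3 * ρ) with hlo | hhi
  · have hU : uU ρ y = 2 * ρ := uU_of_le hρ hlo
    have hpos : 0 < uU ρ y + a := by rw [hU]; have := (abs_le.1 ha).1; linarith
    have hpos' : 0 < uU ρ y + a' := by rw [hU]; have := (abs_le.1 ha').1; linarith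
    obtain ⟨haa, hbb⟩ := switch_inj hχ.1 hχ.2 hpos hpos' hb hb' hsw
    subst haa; subst hbb
    refine ⟨rfl, rfl, rfl, ?_⟩
    have e1 := tubeUp_fst_eq hρ hy ϑ a b
    have e2 := tubeUp_fst_eq hρ hy ϑ' a b
    have hth1 : (tubeUp ρ y ϑ a b).2.2 = ϑ - chiU ρ y * b := rfl
    have hth2 : (tubeUp ρ y ϑ' a b).2.2 = ϑ' - chiU ρ y * b := rfl
    rw [hth1, hth2] at hthd
    have : ϑ = ϑ' := by linarith
    rw [this]
  · -- `χ = 0`: the first component is `(U + a + ib) e^{iϑ}` and the third is `ϑ`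
    have hχ0 : chiU ρ y = 0 := chiU_of_ge hρ hhi.le
    have hth1 : (tubeUp ρ y ϑ a b).2.2 = ϑ := by show ϑ - chiU ρ y * b = ϑ; rw [hχ0]; ring
    have hth2 : (tubeUp ρ y ϑ' a' b').2.2 = ϑ' := by show ϑ' - chiU ρ y * b' = ϑ'; rw [hχ0]; ring
    rw [hth1, hth2] at hthd
    subst hthd
    rw [switchMap, switchMap, hχ0] at hsw
    simp only [zero_mul, Complex.ofReal_zero, Complex.exp_zero, one_mul, sub_zero] at hsw
    have hre := congrArg Complex.re hsw
    have him := congrArg Complex.im hsw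
    simp at hre him
    exact ⟨rfl, by linarith, him, rfl⟩

end Up



end Literature.Topology.FourManifolds
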